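import Literature.Computability.Complexity.ExtMonotoneGates
import Mathlib.Analysis.InnerProductSpace.PiL2
import Mathlib.Analysis.InnerProductSpace.GramSchmidtOrtho
import Mathlib.Analysis.Matrix.Spectrum
import Mathlib.Analysis.Matrix.PosDef
import Mathlib.Algebra.Order.Star.Real
import Mathlib.Algebra.Order.BigOperators.Ring.Finset
import HarnessLib

/-!
# Crux `Capture` (stmt-PneNP-2659) — duality audit, cell D6, part 1 (lemmas): the projector trick for
# REAL CO-RANK doors (`0 ⪯ Y ⪯ I`, `tr Y ≥ r`, `a_iᵀ Y = 0` for unselected `i`) and the SDP transport lemma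

The GRANK door `[rk{a_i : v_i = 1} ≥ θ]` (one linear matroid over `ℝ`) has Boolean dual the CO-RANK door

  `v ↦ [the UNselected equations a_i · y = 0 (v_i = 0) have ≥ r linearly independent solutions]`,
  `r = d − θ + 1` — a DIMENSION LOWER BOUND for the solution space of the unselected homogeneous system.

This file proves that every such door is ONE CONV gate, using the SDP (not just LP) power of the class:
the matrix variable is `Z = [[Y, 0], [0, I − Y]] ⪰ 0` (linear ties make `0 ⪯ Y ⪯ I`), with `tr Y ≥ r` and
`a_iᵀ Y = 0` for unselected `i`, relaxed to `|(a_iᵀ Y)_k| ≤ ‖a_i‖₁ · v_i` for selected `i` (sound because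
`|Y_jk| ≤ 1` automatically). Soundness: `Y a_i = 0 (i unselected)` puts the column space of `Y` inside the
solution space, and `tr Y ≤ rank Y` when `0 ⪯ Y ⪯ I` (spectral theorem: eigenvalues in `[0,1]`);
completeness: `Y` = orthogonal projector onto an `r`-dimensional space of solutions (an orthonormal basis
extended to `ℝ^d`, Parseval). Hence meet-side linear algebra over `ℝ` — dimension lower bounds for solution
spaces of UNselected constraints, the data that grows with the selection — is CONV material; this is the
`ℝ`-counterpart of `dualFullRank_circuit` (`𝔽₂`, `θ = d`) and the engine behind the fixed-level closure
tests for the DUAL-PERM door (`Cruxes/Capture/DUALITY-AUDIT-c7.md`). This part holds the linear algebra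
(`trace_le_rank_of_posSemidef_of_le_one`, `exists_li_solutions_of_projector`,
`exists_projector_of_li_solutions`) and the transport lemma `isConvGate_of_sdp` (registered sub-goal); the
gate is assembled in `ConvexRankGatesCaptureDualRealCorank.lean`. [folklore]
-/

namespace Summit.PneNP.PneNP.Theorems.Capture.DualityAudit

set_option linter.dupNamespace false -- `Summit.PneNP.PneNP.…`: summit = sub-problem (D-0017)

open Literature.Computability.Complexity Finset Matrix

noncomputable section

/-- **`tr P ≤ rank P` when `0 ⪯ P ⪯ I`** (real symmetric `P`: eigenvalues lie in `[0, 1]`, the trace is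
their sum and the rank counts the non-zero ones). [folklore] -/
theorem trace_le_rank_of_posSemidef_of_le_one {d : ℕ} {P : Matrix (Fin d) (Fin d) ℝ}
    (hP : P.PosSemidef) (hP1 : (1 - P).PosSemidef) : P.trace ≤ (P.rank : ℝ) := by
  have hH : P.IsHermitian := hP.1
  rw [hH.trace_eq_sum_eigenvalues, hH.rank_eq_card_non_zero_eigs]
  simp only [RCLike.ofReal_real_eq_id, id_eq]
  -- eigenvalues are in `[0, 1]`
  have h0 : ∀ i, 0 ≤ hH.eigenvalues i := fun i => hP.eigenvalues_nonneg i
  have h1 : ∀ i, hH.eigenvalues i ≤ 1 := fun i => by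
    set v := (hH.eigenvectorBasis i).ofLp with hv
    have hmul : P.mulVec v = hH.eigenvalues i • v := hH.mulVec_eigenvectorBasis i
    have hvpos : 0 < star v ⬝ᵥ v := by
      rw [Matrix.dotProduct_star_self_pos_iff]
      intro h0v
      have := (hH.eigenvectorBasis).orthonormal.1 i
      have hzero : hH.eigenvectorBasis i = 0 := by
        apply (WithLp.ofLp_injective (p := 2))
        simpa [hv] using h0v
      rw [hzero, norm_zero] at this
      exact zero_ne_one this
    have hq := hP1.re_dotProduct_nonneg v
    rw [Matrix.sub_mulVec, Matrix.one_mulVec, hmul, dotProduct_sub, dotProduct_smul] at hq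
    simp only [smul_eq_mul, map_sub, RCLike.re_to_real] at hq
    have hvpos' : 0 < star v ⬝ᵥ v := hvpos
    nlinarith
  -- `Σ λ = Σ_{λ ≠ 0} λ ≤ #{λ ≠ 0}`
  classical
  rw [← Finset.sum_filter_ne_zero, Fintype.card_subtype]
  calc ∑ i ∈ Finset.univ.filter (fun i => hH.eigenvalues i ≠ 0), hH.eigenvalues i
      ≤ ∑ _i ∈ Finset.univ.filter (fun i => hH.eigenvalues i ≠ 0), (1 : ℝ) :=
        Finset.sum_le_sum fun i _ => h1 i
    _ = _ := by simp

/-- **Soundness of the projector gate**: if `P, P' ⪰ 0`, `P + P' = I`, `tr P ≥ r` and `a_iᵀ P = 0` for the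
unselected rows `i ∈ U`, then the unselected homogeneous system has `r` linearly independent solutions
(`r ≤ tr P ≤ rank P`, and the columns of `P` are solutions). [folklore] -/
theorem exists_li_solutions_of_projector {d n r : ℕ} (a : Fin n → Fin d → ℝ) (U : Set (Fin n))
    (P P' : Matrix (Fin d) (Fin d) ℝ) (hP : P.PosSemidef) (hP' : P'.PosSemidef) (hsum : P + P' = 1)
    (htr : (r : ℝ) ≤ P.trace) (hU : ∀ i ∈ U, a i ᵥ* P = 0) :
    ∃ w : Fin r → Fin d → ℝ, LinearIndependent ℝ w ∧ ∀ t, ∀ i ∈ U, a i ⬝ᵥ w t = 0 := by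
  classical
  have h1P : (1 - P).PosSemidef := by
    rw [← hsum, add_sub_cancel_left]
    exact hP'
  have hrank : r ≤ P.rank := by
    have := htr.trans (trace_le_rank_of_posSemidef_of_le_one hP h1P)
    exact_mod_cast this
  -- a linearly independent set of columns of cardinality `rank P ≥ r`
  obtain ⟨b, hb, hspan, hli⟩ := exists_linearIndependent ℝ (Set.range P.col)
  haveI : Fintype b := ((Set.finite_range P.col).subset hb).fintype
  have hcard : r ≤ Fintype.card b := by
    have h1 : Module.finrank ℝ (Submodule.span ℝ b) = b.toFinset.card := finrank_span_set_eq_card hli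
    rw [Set.toFinset_card] at h1
    rw [← h1, hspan, ← Matrix.rank_eq_finrank_span_cols]
    exact hrank
  let emb : Fin r ↪ b := (Fin.castLEEmb hcard).trans (Fintype.equivFin b).symm.toEmbedding
  refine ⟨fun t => ((emb t : b) : Fin d → ℝ), hli.comp emb emb.injective, fun t i hi => ?_⟩
  obtain ⟨k, hk⟩ := hb (emb t).2
  show a i ⬝ᵥ ((emb t : b) : Fin d → ℝ) = 0
  rw [← hk]
  exact congrFun (hU i hi) k

/-- **Completeness of the projector gate**: from `r` linearly independent solutions of the unselected system,
the orthogonal projector `Y₁₁` onto their span (an orthonormal basis of the span, extended to an orthonormal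
basis of `ℝ^d`; `Y₂₂ = I − Y₁₁` from the complementary basis vectors, Parseval) is a feasible point:
`Y = Bᵀ B ⪰ 0`, off-diagonal blocks `0`, `Y₁₁ + Y₂₂ = I`, `tr Y₁₁ = r`, `a_iᵀ Y₁₁ = 0` for `i ∈ U`, and
`|Y₁₁| ≤ 1` entrywise. [folklore] -/
theorem exists_projector_of_li_solutions {d n r : ℕ} (a : Fin n → Fin d → ℝ) (U : Set (Fin n))
    (w : Fin r → Fin d → ℝ) (hw : LinearIndependent ℝ w) (hwU : ∀ t, ∀ i ∈ U, a i ⬝ᵥ w t = 0) :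
    ∃ Y : Matrix (Fin d ⊕ Fin d) (Fin d ⊕ Fin d) ℝ, Y.PosSemidef ∧
      (∀ j k, Y (Sum.inl j) (Sum.inr k) = 0) ∧ (∀ j k, Y (Sum.inr j) (Sum.inl k) = 0) ∧
      (∀ j k, Y (Sum.inl j) (Sum.inl k) + Y (Sum.inr j) (Sum.inr k) = if j = k then 1 else 0) ∧
      (∑ j, Y (Sum.inl j) (Sum.inl j) = r) ∧
      (∀ i ∈ U, ∀ k, ∑ j, a i j * Y (Sum.inl j) (Sum.inl k) = 0) ∧
      (∀ j k, |Y (Sum.inl j) (Sum.inl k)| ≤ 1) := by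
  classical
  -- the solution space and the span of the given solutions, inside `(EuclideanSpace ℝ (Fin d))`
  let K : Submodule ℝ (EuclideanSpace ℝ (Fin d)) :=
    { carrier := {y | ∀ i ∈ U, a i ⬝ᵥ y.ofLp = 0}
      add_mem' := fun {x y} hx hy i hi => by
        show a i ⬝ᵥ (x.ofLp + y.ofLp) = 0
        rw [dotProduct_add, hx i hi, hy i hi, add_zero]
      zero_mem' := fun i _ => by
        show a i ⬝ᵥ (0 : Fin d → ℝ) = 0
        exact dotProduct_zero _
      smul_mem' := fun c x hx i hi => by
        show a i ⬝ᵥ (c • x.ofLp) = 0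
        rw [dotProduct_smul, hx i hi, smul_zero] }
  let x : Fin r → (EuclideanSpace ℝ (Fin d)) := fun t => WithLp.toLp 2 (w t)
  have hxK : ∀ t, x t ∈ K := fun t i hi => by
    show a i ⬝ᵥ (WithLp.toLp 2 (w t)).ofLp = 0
    rw [WithLp.ofLp_toLp]
    exact hwU t i hi
  have hxli : LinearIndependent ℝ x :=
    hw.map' ((WithLp.linearEquiv 2 ℝ (Fin d → ℝ)).symm : (Fin d → ℝ) →ₗ[ℝ] (EuclideanSpace ℝ (Fin d))) (LinearEquiv.ker _)
  let W : Submodule ℝ (EuclideanSpace ℝ (Fin d)) := Submodule.span ℝ (Set.range x)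
  have hWK : W ≤ K := Submodule.span_le.2 (by rintro _ ⟨t, rfl⟩; exact hxK t)
  have hWr : Module.finrank ℝ W = r := by
    rw [finrank_span_eq_card hxli, Fintype.card_fin]
  -- an orthonormal basis of `W`, extended to one of `(EuclideanSpace ℝ (Fin d))`
  let bW := stdOrthonormalBasis ℝ W
  let u₀ : Fin (Module.finrank ℝ W) → (EuclideanSpace ℝ (Fin d)) := fun t => (bW t : (EuclideanSpace ℝ (Fin d)))
  have hu₀ : Orthonormal ℝ u₀ := (W.subtypeₗᵢ.orthonormal_comp_iff).2 bW.orthonormal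
  have hu₀inj : Function.Injective u₀ := hu₀.linearIndependent.injective
  let S : Set (EuclideanSpace ℝ (Fin d)) := Set.range u₀
  have hS : Orthonormal ℝ (Subtype.val : S → (EuclideanSpace ℝ (Fin d))) := (orthonormal_subtype_range hu₀inj).2 hu₀
  have hSK : ∀ y ∈ S, ∀ i ∈ U, a i ⬝ᵥ (WithLp.ofLp y) = 0 := by
    rintro _ ⟨t, rfl⟩ i hi
    exact hWK (bW t).2 i hi
  obtain ⟨u, b, hSu, hb⟩ := hS.exists_orthonormalBasis_extension
  have hbx : ∀ y : u, (b y : (EuclideanSpace ℝ (Fin d))) = (y : (EuclideanSpace ℝ (Fin d))) := fun y => by rw [hb]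
  -- coordinates, Parseval
  let f : u → Fin d → ℝ := fun y => (y : (EuclideanSpace ℝ (Fin d))).ofLp
  have hparseval : ∀ j k, ∑ y : u, f y j * f y k = if j = k then 1 else 0 := fun j k => by
    have h := b.sum_inner_mul_inner (EuclideanSpace.single j (1 : ℝ)) (EuclideanSpace.single k (1 : ℝ))
    have hjk : inner ℝ (EuclideanSpace.single j (1 : ℝ)) (EuclideanSpace.single k (1 : ℝ)) =
        if j = k then 1 else 0 :=
      orthonormal_iff_ite.1 (EuclideanSpace.orthonormal_single (𝕜 := ℝ) (ι := Fin d)) j k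
    rw [hjk] at h
    rw [← h]
    refine Finset.sum_congr rfl fun y _ => ?_
    rw [hbx, EuclideanSpace.inner_single_left, EuclideanSpace.inner_single_right]
    simp [f]
  have hnorm : ∀ y : u, ∑ j, f y j * f y j = 1 := fun y => by
    have h1 : ‖(b y : (EuclideanSpace ℝ (Fin d)))‖ = 1 := b.orthonormal.1 y
    rw [hbx] at h1
    have h2 : inner ℝ (y : (EuclideanSpace ℝ (Fin d))) (y : (EuclideanSpace ℝ (Fin d))) = ∑ j, f y j * f y j := by
      rw [EuclideanSpace.inner_eq_star_dotProduct]
      simp [dotProduct, f]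
    rw [← h2, real_inner_self_eq_norm_sq, h1, one_pow]
  -- `#(u ∩ S) = r`
  have hcardS : (Finset.univ.filter fun y : u => (y : (EuclideanSpace ℝ (Fin d))) ∈ S).card = r := by
    rw [← Fintype.card_subtype]
    have e1 : {y : u // (y : (EuclideanSpace ℝ (Fin d))) ∈ S} ≃ S := Equiv.subtypeSubtypeEquivSubtype (fun {y} hy => hSu hy)
    rw [Fintype.card_congr e1, Set.card_range_of_injective hu₀inj, Fintype.card_fin, hWr]
  -- the matrix `Y = Bᵀ B`
  let g : u → Fin d → ℝ := fun y j => if (y : (EuclideanSpace ℝ (Fin d))) ∈ S then f y j else 0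
  let g' : u → Fin d → ℝ := fun y j => if (y : (EuclideanSpace ℝ (Fin d))) ∈ S then 0 else f y j
  let Bm : Matrix u (Fin d ⊕ Fin d) ℝ := fun y q => Sum.elim (g y) (g' y) q
  let Y : Matrix (Fin d ⊕ Fin d) (Fin d ⊕ Fin d) ℝ := Bm.conjTranspose * Bm
  have hYapply : ∀ p q, Y p q = ∑ y, Bm y p * Bm y q := fun p q => by
    simp only [Y, Matrix.mul_apply, Matrix.conjTranspose_apply, star_trivial]
  have hgg' : ∀ y j k, g y j * g' y k = 0 := fun y j k => by
    simp only [g, g']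
    split_ifs <;> simp
  have hsum_gg : ∀ y j k, g y j * g y k + g' y j * g' y k = f y j * f y k := fun y j k => by
    simp only [g, g']
    split_ifs <;> simp
  have hg2 : ∀ y j, g y j * g y j ≤ f y j * f y j := fun y j => by
    simp only [g]
    split_ifs
    · exact le_rfl
    · simpa using mul_self_nonneg (f y j)
  refine ⟨Y, Matrix.posSemidef_conjTranspose_mul_self Bm, fun j k => ?_, fun j k => ?_, fun j k => ?_,
    ?_, fun i hi k => ?_, fun j k => ?_⟩
  · rw [hYapply]
    exact Finset.sum_eq_zero fun y _ => hgg' y j k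
  · rw [hYapply]
    exact Finset.sum_eq_zero fun y _ => by rw [mul_comm]; exact hgg' y k j
  · rw [hYapply, hYapply, ← Finset.sum_add_distrib, ← hparseval j k]
    exact Finset.sum_congr rfl fun y _ => hsum_gg y j k
  · simp only [hYapply]
    rw [Finset.sum_comm]
    have hin : ∀ y : u, ∑ j, Bm y (Sum.inl j) * Bm y (Sum.inl j) = if (y : (EuclideanSpace ℝ (Fin d))) ∈ S then 1 else 0 := fun y => by
      simp only [Bm, Sum.elim_inl, g]
      split_ifs with hy
      · exact hnorm y
      · simp
    rw [Finset.sum_congr rfl fun y _ => hin y, Finset.sum_ite, Finset.sum_const_zero, add_zero,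
      Finset.sum_const, nsmul_eq_mul, mul_one, hcardS]
  · simp only [hYapply, Finset.mul_sum]
    rw [Finset.sum_comm]
    refine Finset.sum_eq_zero fun y _ => ?_
    have : ∑ j, a i j * (Bm y (Sum.inl j) * Bm y (Sum.inl k)) = (∑ j, a i j * g y j) * g y k := by
      rw [Finset.sum_mul]
      exact Finset.sum_congr rfl fun j _ => by simp only [Bm, Sum.elim_inl]; ring
    rw [this]
    by_cases hy : (y : (EuclideanSpace ℝ (Fin d))) ∈ S
    · have h0 : ∑ j, a i j * g y j = 0 := by
        simp only [g, if_pos hy]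
        exact hSK _ hy i hi
      rw [h0, zero_mul]
    · simp [g, hy]
  · rw [← sq_le_one_iff_abs_le_one, hYapply]
    simp only [Bm, Sum.elim_inl]
    have hcs := Finset.sum_mul_sq_le_sq_mul_sq Finset.univ (fun y => g y j) (fun y => g y k)
    have hj : ∑ y, g y j ^ 2 ≤ 1 := by
      calc ∑ y, g y j ^ 2 ≤ ∑ y, f y j * f y j := Finset.sum_le_sum fun y _ => by rw [sq]; exact hg2 y j
        _ = 1 := by rw [hparseval, if_pos rfl]
    have hk : ∑ y, g y k ^ 2 ≤ 1 := by
      calc ∑ y, g y k ^ 2 ≤ ∑ y, f y k * f y k := Finset.sum_le_sum fun y _ => by rw [sq]; exact hg2 y k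
        _ = 1 := by rw [hparseval, if_pos rfl]
    have h0j : 0 ≤ ∑ y, g y j ^ 2 := Finset.sum_nonneg fun y _ => sq_nonneg _
    calc (∑ y, g y j * g y k) ^ 2 ≤ (∑ y, g y j ^ 2) * ∑ y, g y k ^ 2 := hcs
      _ ≤ 1 * 1 := mul_le_mul hj hk (Finset.sum_nonneg fun y _ => sq_nonneg _) zero_le_one
      _ = 1 := one_mul 1

/-- Trace is invariant under conjugating the index type by an equivalence. [folklore] -/
theorem trace_submatrix_equiv {Q : Type} [Fintype Q] {m : ℕ} (M : Matrix Q Q ℝ) (e : Fin m ≃ Q) :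
    (M.submatrix e e).trace = M.trace :=
  Fintype.sum_equiv e _ _ fun _ => rfl

/-- **Transport**: an SDP-feasibility description with rows indexed by any finite type `R` and a matrix
variable indexed by any finite type `Q` is a CONV gate of width `|R| + |Q|`. [folklore] -/
theorem isConvGate_of_sdp : ∀ {n : ℕ} {R Q : Type} [Fintype R] [Fintype Q] [DecidableEq Q]
    (A : R → Matrix Q Q ℝ) (b : R → ℝ) (B : R → Fin n → ℝ), (∀ i k, 0 ≤ B i k) →
    ∀ (f : (Fin n → Bool) → Bool), (∀ v, f v = true ↔ ∃ Y : Matrix Q Q ℝ, Y.PosSemidef ∧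
      ∀ i, (A i * Y).trace ≤ b i + ∑ k, B i k * (if v k then (1 : ℝ) else 0)) →
    IsConvGate (Fintype.card R + Fintype.card Q) ⟨n, f⟩ := by
  intro n R Q _ _ _ A b B hB f hf
  classical
  let eR := Fintype.equivFin R
  let eQ := Fintype.equivFin Q
  refine ⟨Fintype.card R, Fintype.card Q, le_rfl, fun i => (A (eR.symm i)).submatrix eQ.symm eQ.symm,
    fun i => b (eR.symm i), fun i k => B (eR.symm i) k, fun i k => hB _ _, fun v => ?_⟩
  show f v = true ↔ _
  rw [hf v]
  have hkey : ∀ (M : Matrix Q Q ℝ) (Y' : Matrix (Fin (Fintype.card Q)) (Fin (Fintype.card Q)) ℝ),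
      (M.submatrix eQ.symm eQ.symm * Y').trace = (M * Y'.submatrix eQ eQ).trace := fun M Y' => by
    have hY' : Y' = (Y'.submatrix eQ eQ).submatrix eQ.symm eQ.symm := by
      rw [Matrix.submatrix_submatrix, Equiv.self_comp_symm, Matrix.submatrix_id_id]
    conv_lhs => rw [hY', Matrix.submatrix_mul_equiv]
    exact trace_submatrix_equiv _ eQ.symm
  constructor
  · rintro ⟨Y, hY, hc⟩
    refine ⟨Y.submatrix eQ.symm eQ.symm, hY.submatrix _, fun i => ?_⟩
    rw [hkey, show (Y.submatrix eQ.symm eQ.symm).submatrix eQ eQ = Y by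
      rw [Matrix.submatrix_submatrix, Equiv.symm_comp_self, Matrix.submatrix_id_id]]
    exact hc (eR.symm i)
  · rintro ⟨Y', hY', hc'⟩
    refine ⟨Y'.submatrix eQ eQ, hY'.submatrix _, fun r => ?_⟩
    have h := hc' (eR r)
    rw [hkey] at h
    simpa only [Equiv.symm_apply_apply] using h

end

end Summit.PneNP.PneNP.Theorems.Capture.DualityAudit
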